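import Mathlib
import Summits.NavierStokesRegularity.NavierStokesRegularity.Theorems.FilamentSkeletonRssDefectColumnGateDefs
import Summits.NavierStokesRegularity.NavierStokesRegularity.Theorems.FilamentSkeletonRssKelvinGateClosingPicard
import Summits.NavierStokesRegularity.NavierStokesRegularity.Theorems.FilamentSkeletonRssKelvinGateClosingStatic

/-!
# Route `FilamentSkeletonRss` · crux `TransverseReduction1AG` (stmt-27853) · line of record `defect_column_gate_1AG` — STUB S3a
# `stub_closingIVT1AG : ClosingIVT1AG` (= `DefectContinuity1AG → DefectClosing1AG`), PROVED

LEAD of 27853 (lane ns-filament-21221-p1 g9, DIRECTOR-NS #238), 2026-08-28; `--supports stmt-NavierStokesRegularity-27853` (registered stub, by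
name).  HONEST FRAMING: the ANALYTIC/ALGEBRAIC half of the closing step of a HYPOTHETICAL filament-type rotating-self-similar blow-up
route (MODEL rung, negative side): frozen-rate contraction at each rate of the window + intermediate-value theorem on the scalar defect +
conclusion bookkeeping, GIVEN the continuity of the defect coefficient (stub S3b `DefectContinuity1AG`, open).  Nothing here bears on
Navier–Stokes regularity; `TransverseReduction1AG` is neither proved nor refuted.

Proof.  Fix the box, `Cs, κ, C₂, q₀, k₀`.  Take `q₁ := q₀`, `k := max (max k₀ 1) (⌈2|κ| + |q₁|⌉₊ + 2)` (so `k ≥ 2κ+1` and `κ − k + q₁ ≤ −2`),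
and for given `C_r` the threshold `Γ₁ := max 1 (64C₂²|C_r| + 4|C₂||C_r| + 4|C₂||C_r|/η + 2)`.  For `Γ ≥ Γ₁`, a skeleton, a family
(`FamilySpec1AG`) and a gate (`DefectGateSpec1AG`): with `ε := C_rΓ^{-k}`, `A := C₂Γ^κ` one has `64A²ε ≤ 1`; at each `|β| ≤ β₀` the landed
Picard iteration (`KelvinGate.picard_exists_fixedPoint`, gate clauses (1)(2)) gives `G_β` with `Y(G_β) ≤ 2ε`,
`G_β = −r_β − D(𝓚_βG_β)[𝓚_βG_β]`; S3b makes `b(β) := 𝓫_β G_β` continuous on `[−β₀, β₀]`, and `|b| ≤ 2Aε < Γ^{-q₁}`; the family's sign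
clause for `g` and the IVT give `β*` with `g(β*) = b(β*)`; then `U := U⁰_{β*} + 𝓚G`, `P := P⁰_{β*} + 𝓠G`, `α₁ := α⁰ + β*` satisfy
`AlmostConcl1AG`: `E_{α₁}(U) + ∇P = (r + gZ) + (G − bZ) + D(𝓚G)[𝓚G] = (g − b)Z = 0`, `α₁ ≠ 0` (`|α| ≥ θ₀`, `|α⁰ − α| ≤ θ₀/4`, `|β*| ≤ θ₀/4`),
`U ≠ 0` (unit of mass vs `‖𝓚G‖ ≤ 2Aε ≤ ½`), decay `(CsΓ⁴ + 2Aε)/(1+|y|)`, pressure bound, waist closeness (`2Aε ≤ η√Γ/2`).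
-/

set_option linter.dupNamespace false

noncomputable section

namespace Summit.NavierStokesRegularity.NavierStokesRegularity.Theorems.DefectColumnGate

open scoped BigOperators Topology InnerProductSpace ContDiff
open Filter Set Function MeasureTheory
open Literature.Analysis.FluidPDE
open Summit.NavierStokesRegularity.NavierStokesRegularity.Theses.FilamentSkeletonRss
open Summit.NavierStokesRegularity.NavierStokesRegularity.Theorems.KelvinGate

/-! ## Thresholds -/

/-- Numerology of the closing: for `Γ ≥ 1`, `k ≥ 2κ+1`, `k ≥ 1`, `κ − k + q₁ ≤ −2` and `Γ ≥ 64C₂²|C_r| + 4|C₂||C_r| + 4|C₂||C_r|/η + 2`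
(`η > 0`, `C_r ≥ 0`): with `A := C₂Γ^κ`, `ε := C_rΓ^{-k}`: `64A²ε ≤ 1`, `2Aε ≤ 1/2`, `2Aε ≤ η√Γ/2`, and `|2Aε'| < Γ^{-q₁}` for the
defect coefficient bound `A·(2ε)`. -/
theorem closing_thresholds {Γ κ C₂ Cr q₁ η : ℝ} {k : ℕ} (hΓ1 : 1 ≤ Γ) (hk : 2 * κ + 1 ≤ k) (hk1 : 1 ≤ k) (hkq : κ - (k:ℝ) + q₁ ≤ -2)
    (hη : 0 < η) (hCr : 0 ≤ Cr) (hΓbig : 64 * C₂ ^ 2 * |Cr| + 4 * |C₂| * |Cr| + 4 * |C₂| * |Cr| / η + 2 ≤ Γ) :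
    64 * (C₂ * Γ ^ κ) ^ 2 * (Cr * Γ ^ (-(k:ℝ))) ≤ 1 ∧ 2 * (C₂ * Γ ^ κ) * (Cr * Γ ^ (-(k:ℝ))) ≤ 1 / 2 ∧
      2 * (C₂ * Γ ^ κ) * (Cr * Γ ^ (-(k:ℝ))) ≤ η * √Γ / 2 ∧ C₂ * Γ ^ κ * (2 * (Cr * Γ ^ (-(k:ℝ)))) < Γ ^ (-q₁) := by
  have hΓ0 : 0 < Γ := by linarith
  obtain ⟨ht1, ht2⟩ := rpow_gate_threshold (κ := κ) hΓ1 hk hk1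
  have hCrabs : |Cr| = Cr := abs_of_nonneg hCr
  have hΓκ : 0 ≤ Γ ^ κ := Real.rpow_nonneg hΓ0.le κ
  have hΓk : 0 ≤ Γ ^ (-(k:ℝ)) := Real.rpow_nonneg hΓ0.le _
  have hnn1 : 0 ≤ 64 * C₂ ^ 2 * |Cr| := by positivity
  have hnn2 : 0 ≤ 4 * |C₂| * |Cr| := by positivity
  have hnn3 : 0 ≤ 4 * |C₂| * |Cr| / η := by positivity
  have hACr : C₂ * Cr ≤ |C₂| * |Cr| := by rw [← abs_mul]; exact le_abs_self _
  -- `2Aε ≤ 2|C₂||Cr| Γ⁻¹`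
  have h2Aε : 2 * (C₂ * Γ ^ κ) * (Cr * Γ ^ (-(k:ℝ))) ≤ 2 * |C₂| * |Cr| * Γ⁻¹ := by
    have e : 2 * (C₂ * Γ ^ κ) * (Cr * Γ ^ (-(k:ℝ))) = 2 * (C₂ * Cr) * (Γ ^ κ * Γ ^ (-(k:ℝ))) := by ring
    rw [e]
    calc 2 * (C₂ * Cr) * (Γ ^ κ * Γ ^ (-(k:ℝ))) ≤ 2 * (|C₂| * |Cr|) * (Γ ^ κ * Γ ^ (-(k:ℝ))) :=
          mul_le_mul_of_nonneg_right (mul_le_mul_of_nonneg_left hACr (by norm_num)) (mul_nonneg hΓκ hΓk)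
      _ ≤ 2 * (|C₂| * |Cr|) * Γ⁻¹ := mul_le_mul_of_nonneg_left ht2 (by positivity)
      _ = 2 * |C₂| * |Cr| * Γ⁻¹ := by ring
  have hdivΓ : 2 * |C₂| * |Cr| * Γ⁻¹ = (2 * |C₂| * |Cr|) / Γ := by rw [div_eq_mul_inv]
  refine ⟨?_, ?_, ?_, ?_⟩
  · -- `64 A² ε ≤ 1`
    have e : 64 * (C₂ * Γ ^ κ) ^ 2 * (Cr * Γ ^ (-(k:ℝ))) = 64 * C₂ ^ 2 * Cr * ((Γ ^ κ) ^ 2 * Γ ^ (-(k:ℝ))) := by ring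
    rw [e]
    have h1 : 64 * C₂ ^ 2 * Cr * ((Γ ^ κ) ^ 2 * Γ ^ (-(k:ℝ))) ≤ 64 * C₂ ^ 2 * Cr * Γ⁻¹ :=
      mul_le_mul_of_nonneg_left ht1 (by positivity)
    have h2 : 64 * C₂ ^ 2 * Cr * Γ⁻¹ ≤ 1 := by
      rw [show 64 * C₂ ^ 2 * Cr * Γ⁻¹ = (64 * C₂ ^ 2 * Cr) / Γ by rw [div_eq_mul_inv], div_le_one hΓ0]
      rw [hCrabs] at hnn1 hnn2 hnn3 hΓbig; linarith
    exact h1.trans h2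
  · refine h2Aε.trans ?_
    rw [hdivΓ, div_le_iff₀ hΓ0]; linarith
  · refine h2Aε.trans ?_
    have hsqrt : 1 ≤ √Γ := by rw [show (1:ℝ) = √1 by simp]; exact Real.sqrt_le_sqrt hΓ1
    have h1 : 2 * |C₂| * |Cr| * Γ⁻¹ ≤ η / 2 := by
      rw [hdivΓ, div_le_iff₀ hΓ0]
      have e : 4 * |C₂| * |Cr| / η * η = 4 * |C₂| * |Cr| := div_mul_cancel₀ _ hη.ne'
      have h4 : 4 * |C₂| * |Cr| / η ≤ Γ := by linarith
      have h5 : 4 * |C₂| * |Cr| ≤ η * Γ := by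
        calc 4 * |C₂| * |Cr| = 4 * |C₂| * |Cr| / η * η := e.symm
          _ ≤ Γ * η := mul_le_mul_of_nonneg_right h4 hη.le
          _ = η * Γ := mul_comm _ _
      linarith
    calc 2 * |C₂| * |Cr| * Γ⁻¹ ≤ η / 2 := h1
      _ = η * 1 / 2 := by ring
      _ ≤ η * √Γ / 2 := by gcongr
  · -- `A · 2ε < Γ^{-q₁}`: `A·2ε = 2 C₂ C_r Γ^{κ-k} ≤ 2|C₂||C_r| Γ^{-q₁-2} < Γ^{-q₁}`
    have hexp : Γ ^ (κ - (k:ℝ)) ≤ Γ ^ (-q₁ - 2) := Real.rpow_le_rpow_of_exponent_le hΓ1 (by linarith)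
    have hsplit : Γ ^ (-q₁ - 2) = Γ ^ (-q₁) * Γ ^ (-(2:ℝ)) := by
      rw [← Real.rpow_add hΓ0]; ring_nf
    have hΓq : 0 < Γ ^ (-q₁) := Real.rpow_pos_of_pos hΓ0 _
    have hΓ2 : Γ ^ (-(2:ℝ)) ≤ Γ⁻¹ := by
      rw [show Γ⁻¹ = Γ ^ (-(1:ℝ)) by rw [Real.rpow_neg_one]]
      exact Real.rpow_le_rpow_of_exponent_le hΓ1 (by norm_num)
    have hsmall : 2 * |C₂| * |Cr| * Γ⁻¹ < 1 := by
      rw [hdivΓ, div_lt_one hΓ0]; linarith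
    calc C₂ * Γ ^ κ * (2 * (Cr * Γ ^ (-(k:ℝ)))) = 2 * (C₂ * Cr) * (Γ ^ κ * Γ ^ (-(k:ℝ))) := by ring
      _ = 2 * (C₂ * Cr) * Γ ^ (κ - (k:ℝ)) := by rw [← Real.rpow_add hΓ0, ← sub_eq_add_neg]
      _ ≤ 2 * (|C₂| * |Cr|) * Γ ^ (κ - (k:ℝ)) :=
          mul_le_mul_of_nonneg_right (mul_le_mul_of_nonneg_left hACr (by norm_num)) (Real.rpow_nonneg hΓ0.le _)
      _ ≤ 2 * (|C₂| * |Cr|) * Γ ^ (-q₁ - 2) := mul_le_mul_of_nonneg_left hexp (by positivity)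
      _ = (2 * |C₂| * |Cr| * Γ ^ (-(2:ℝ))) * Γ ^ (-q₁) := by rw [hsplit]; ring
      _ ≤ (2 * |C₂| * |Cr| * Γ⁻¹) * Γ ^ (-q₁) :=
          mul_le_mul_of_nonneg_right (mul_le_mul_of_nonneg_left hΓ2 (by positivity)) hΓq.le
      _ < 1 * Γ ^ (-q₁) := mul_lt_mul_of_pos_right hsmall hΓq
      _ = Γ ^ (-q₁) := one_mul _

/-! ## The conclusion from a family member, a gate and a balanced fixed point -/

/-- **Conclusion bookkeeping.**  At a member `β` of a family and a gate around it, a fixed point `G` of the frozen-rate Picard map with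
`Y(G) ≤ 2ε` whose defect coefficient BALANCES the family's scalar defect, `g(β) = 𝓫_β G`, gives the crux's `C²/C¹` conclusion block with
`α₁ = α⁰ + β`, provided `2Aε ≤ 1/2`, `2Aε ≤ η√Γ/2` and `α⁰ + β ≠ 0`. -/
theorem almostConcl_of_balanced {N : ℕ} {Γ ρ η Rw Rb θ₀ : ℝ} {k : ℕ} {Cs Cr q₁ κ C₂ : ℝ} {α : ℝ}
    {X : Fin N → ℝ → EuclideanSpace ℝ (Fin 3)} {u : (Fin N → ℝ → EuclideanSpace ℝ (Fin 3)) → EuclideanSpace ℝ (Fin 3) → EuclideanSpace ℝ (Fin 3)}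
    {α0 β₀ : ℝ} {U0 : ℝ → EuclideanSpace ℝ (Fin 3) → EuclideanSpace ℝ (Fin 3)} {P0 : ℝ → EuclideanSpace ℝ (Fin 3) → ℝ}
    {Z : ℝ → EuclideanSpace ℝ (Fin 3) → EuclideanSpace ℝ (Fin 3)} {g : ℝ → ℝ} {r : ℝ → EuclideanSpace ℝ (Fin 3) → EuclideanSpace ℝ (Fin 3)}
    {𝓚 : ℝ → (EuclideanSpace ℝ (Fin 3) → EuclideanSpace ℝ (Fin 3)) → EuclideanSpace ℝ (Fin 3) → EuclideanSpace ℝ (Fin 3)}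
    {𝓠 : ℝ → (EuclideanSpace ℝ (Fin 3) → EuclideanSpace ℝ (Fin 3)) → EuclideanSpace ℝ (Fin 3) → ℝ}
    {𝓫 : ℝ → (EuclideanSpace ℝ (Fin 3) → EuclideanSpace ℝ (Fin 3)) → ℝ}
    (hfam : FamilySpec1AG N Γ ρ η Rw Rb θ₀ k Cs Cr q₁ α X u α0 β₀ U0 P0 Z g r)
    (hgate : DefectGateSpec1AG Γ κ C₂ β₀ α0 U0 Z 𝓚 𝓠 𝓫) {β : ℝ} (hβ : |β| ≤ β₀)
    {G : EuclideanSpace ℝ (Fin 3) → EuclideanSpace ℝ (Fin 3)} (hG : YBound G (2 * (Cr * Γ ^ (-(k:ℝ)))))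
    (hfix : ∀ y, G y = -r β y - fderiv ℝ (𝓚 β G) y (𝓚 β G y)) (hbal : g β = 𝓫 β G)
    (hhalf : 2 * (C₂ * Γ ^ κ) * (Cr * Γ ^ (-(k:ℝ))) ≤ 1 / 2) (hηΓ : 2 * (C₂ * Γ ^ κ) * (Cr * Γ ^ (-(k:ℝ))) ≤ η * √Γ / 2)
    (hα₁ : α0 + β ≠ 0) :
    ∃ (C₀ M : ℝ) (U : EuclideanSpace ℝ (Fin 3) → EuclideanSpace ℝ (Fin 3)) (P : EuclideanSpace ℝ (Fin 3) → ℝ),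
      AlmostConcl1AG N Γ ρ η Rw X u (α0 + β) C₀ M U P := by
  obtain ⟨-, -, -, -, -, -, hmem, -⟩ := hfam
  obtain ⟨hU0s, hP0s, hdiv0, hU0X, hP0b, ⟨y₀, -, hy₀⟩, hwaist, -, -, -, -, -, hres⟩ := hmem β hβ
  obtain ⟨hW, hQ1, hQb, -, hdivW, heq⟩ := (hgate.1 β hβ).1 G _ hG
  set ε : ℝ := Cr * Γ ^ (-(k:ℝ)) with hε
  set A : ℝ := C₂ * Γ ^ κ with hA
  set W := 𝓚 β G with hWdef
  set Q := 𝓠 β G with hQdef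
  have hU02 : ContDiff ℝ 2 (U0 β) := hU0s.of_le (WithTop.coe_le_coe.mpr (le_top : ((2 : ℕ) : ℕ∞) ≤ ⊤))
  have hP01 : ContDiff ℝ 1 (P0 β) := hP0s.of_le (WithTop.coe_le_coe.mpr (le_top : ((1 : ℕ) : ℕ∞) ≤ ⊤))
  have hWb : ∀ y, ‖W y‖ ≤ 2 * A * ε := fun y => by
    have h1 := (hW.2 y).1
    have h2 : ‖W y‖ ≤ (1 + ‖y‖) * ‖W y‖ := le_mul_of_one_le_left (norm_nonneg _) (by linarith [norm_nonneg y])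
    linarith
  refine ⟨Cs * Γ ^ 4 + 2 * A * ε, Cs * Γ ^ 4 + 2 * A * ε, fun z => U0 β z + W z, fun z => P0 β z + Q z,
    hα₁, ?_, hU02.add hW.1, hP01.add hQ1, ?_, fun y => ?_, fun y => ?_, fun y => ?_, fun y hy htube => ?_⟩
  · -- `U ≠ 0`
    intro hzero
    have h0 : U0 β y₀ + W y₀ = 0 := by simpa using congrFun hzero y₀
    have hW0 : ‖W y₀‖ ≤ 1 / 2 := (hWb y₀).trans hhalf
    have : U0 β y₀ = -W y₀ := eq_neg_of_add_eq_zero_left h0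
    rw [this, norm_neg] at hy₀
    linarith
  · exact isDivFree_add hdiv0 hdivW (hU02.differentiable (by norm_num)) (hW.1.differentiable (by norm_num))
  · -- the profile equation, pointwise
    show lerayOp (α0 + β) (fun z => U0 β z + W z) y + gradient (fun z => P0 β z + Q z) y = 0
    have hQd : DifferentiableAt ℝ Q y := (hQ1.differentiable (by norm_num)) y
    rw [lerayOp_add_eq (α0 + β) (U0 β) W y hU02.contDiffAt hW.1.contDiffAt, gradient_fun_add' ((hP01.differentiable (by norm_num)) y) hQd]
    have e : lerayOp (α0 + β) (U0 β) y + lerayLin (α0 + β) (U0 β) W y + fderiv ℝ W y (W y) + (gradient (P0 β) y + gradient Q y) =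
        (lerayOp (α0 + β) (U0 β) y + gradient (P0 β) y) + (lerayLin (α0 + β) (U0 β) W y + gradient Q y) + fderiv ℝ W y (W y) := by abel
    have heq' : lerayLin (α0 + β) (U0 β) W y + gradient Q y = G y - 𝓫 β G • Z β y := by
      rw [← heq y]; abel
    rw [e, hres y, heq', hfix y, hbal]
    abel
  · -- decay
    have hy1 : 0 < 1 + ‖y‖ := by positivity
    rw [le_div_iff₀ hy1]
    have h1 : ‖U0 β y‖ * (1 + ‖y‖) ≤ Cs * Γ ^ 4 := by rw [mul_comm]; exact (hU0X.2 y).1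
    have h2 : ‖W y‖ * (1 + ‖y‖) ≤ 2 * A * ε := by
      have := (hW.2 y).1; rw [mul_comm] at this; linarith
    calc ‖U0 β y + W y‖ * (1 + ‖y‖) ≤ (‖U0 β y‖ + ‖W y‖) * (1 + ‖y‖) :=
          mul_le_mul_of_nonneg_right (norm_add_le _ _) hy1.le
      _ = ‖U0 β y‖ * (1 + ‖y‖) + ‖W y‖ * (1 + ‖y‖) := by ring
      _ ≤ Cs * Γ ^ 4 + 2 * A * ε := by linarith
  · calc |P0 β y + Q y| ≤ |P0 β y| + |Q y| := abs_add_le _ _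
      _ ≤ Cs * Γ ^ 4 + 2 * A * ε := by linarith [hP0b y, hQb y]
  · calc ‖U0 β y + W y - u X y‖ = ‖(U0 β y - u X y) + W y‖ := by abel_nf
      _ ≤ ‖U0 β y - u X y‖ + ‖W y‖ := norm_add_le _ _
      _ ≤ η * √Γ / 2 + η * √Γ / 2 := add_le_add (hwaist y hy htube) ((hWb y).trans hηΓ)
      _ = η * √Γ := by ring

/-! ## The stub -/

/-- **STUB S3a `ClosingIVT1AG` OF LINE `defect_column_gate_1AG`, PROVED** (registered signature, by name):
`DefectContinuity1AG → DefectClosing1AG`. -/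
theorem stub_closingIVT1AG : ClosingIVT1AG := by
  intro hcontS N δ ρ K Λ a b cnd η Rw Rb cg θ₀ KA hN hδ hρ ha hη hRw hRb hcg hθ₀ Cs κ C₂ q₀ k₀
  refine ⟨q₀, le_rfl, max (max k₀ 1) (⌈2 * |κ| + |q₀|⌉₊ + 2), le_trans (le_max_left _ _) (le_max_left _ _),
    le_trans (le_max_right _ _) (le_max_left _ _), ?_⟩
  set k : ℕ := max (max k₀ 1) (⌈2 * |κ| + |q₀|⌉₊ + 2) with hk
  intro Cr
  refine ⟨max 1 (64 * C₂ ^ 2 * |Cr| + 4 * |C₂| * |Cr| + 4 * |C₂| * |Cr| / η + 2), ?_⟩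
  intro Γ hΓ γ α X w c m n Aa u v A T hu hv hA hT hcl α0 β₀ U0 P0 Z g r hfam 𝓚 𝓠 𝓫 hgate
  have hΓ1 : 1 ≤ Γ := le_trans (le_max_left _ _) hΓ
  have hΓbig : 64 * C₂ ^ 2 * |Cr| + 4 * |C₂| * |Cr| + 4 * |C₂| * |Cr| / η + 2 ≤ Γ := le_trans (le_max_right _ _) hΓ
  have hΓ0 : 0 < Γ := by linarith
  -- the order `k`
  have hk1 : 1 ≤ k := le_trans (le_max_right _ _) (le_max_left _ _)
  have hkR : 2 * |κ| + |q₀| + 2 ≤ (k:ℝ) := by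
    have h1 : ((⌈2 * |κ| + |q₀|⌉₊ + 2 : ℕ) : ℝ) ≤ (k:ℝ) := by exact_mod_cast le_max_right (max k₀ 1) (⌈2 * |κ| + |q₀|⌉₊ + 2)
    push_cast at h1
    linarith [Nat.le_ceil (2 * |κ| + |q₀|)]
  have hk2κ : 2 * κ + 1 ≤ (k:ℝ) := by linarith [le_abs_self κ, abs_nonneg q₀]
  have hkq : κ - (k:ℝ) + q₀ ≤ -2 := by linarith [le_abs_self κ, le_abs_self q₀, abs_nonneg κ]
  -- family facts
  obtain ⟨hβ₀, hβθ, -, hα0, hgcont, hsign, hmem, -⟩ := id hfam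
  have habs1 : |(-β₀)| ≤ β₀ := by rw [abs_neg, abs_of_pos hβ₀]
  have habs2 : |β₀| ≤ β₀ := by rw [abs_of_pos hβ₀]
  have hres : ∀ β, |β| ≤ β₀ → YBound (r β) (Cr * Γ ^ (-(k:ℝ))) := fun β hβ => (hmem β hβ).2.2.2.2.2.2.2.2.2.2.1
  have hCr : 0 ≤ Cr := by
    have hε0 : 0 ≤ Cr * Γ ^ (-(k:ℝ)) := (hres β₀ habs2).nonneg
    have hpos : 0 < Γ ^ (-(k:ℝ)) := Real.rpow_pos_of_pos hΓ0 _
    by_contra hneg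
    push Not at hneg
    have : Cr * Γ ^ (-(k:ℝ)) < 0 := mul_neg_of_neg_of_pos hneg hpos
    linarith
  obtain ⟨h64, hhalf, hηΓ, hbq⟩ := closing_thresholds hΓ1 hk2κ hk1 hkq hη hCr hΓbig
  set ε : ℝ := Cr * Γ ^ (-(k:ℝ)) with hε
  set Ag : ℝ := C₂ * Γ ^ κ with hAg
  have hε0 : 0 ≤ ε := (hres β₀ habs2).nonneg
  have h16 : 16 * Ag ^ 2 * ε ≤ 1 := by nlinarith [sq_nonneg Ag]
  -- per-β frozen-rate Picard
  have hpic : ∀ β, |β| ≤ β₀ → ∃ F : EuclideanSpace ℝ (Fin 3) → EuclideanSpace ℝ (Fin 3),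
      YBound F (2 * ε) ∧ ∀ y, F y = -r β y - fderiv ℝ (𝓚 β F) y (𝓚 β F y) := by
    intro β hβ
    obtain ⟨hcl1, hcl2⟩ := hgate.1 β hβ
    exact picard_exists_fixedPoint (K := 𝓚 β) (A := Ag) (fun F R hF => (hcl1 F R hF).1)
      (fun F G s hF hG => (hcl2 F G s hF hG).1) (hres β hβ) h16
  choose! G hG using hpic
  -- continuity of the defect coefficient (stub S3b) and its bound
  have hcont : ContinuousOn (fun β => 𝓫 β (G β)) (Icc (-β₀) β₀) :=
    hcontS N Γ ρ η Rw Rb θ₀ k Cs Cr q₀ κ C₂ α X u α0 β₀ U0 P0 Z g r hfam 𝓚 𝓠 𝓫 hgate h64 G hG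
  have hb : ∀ β, |β| ≤ β₀ → |𝓫 β (G β)| < Γ ^ (-q₀) := by
    intro β hβ
    have h := (((hgate.1 β hβ).1) (G β) _ (hG β hβ).1).2.2.2.1
    exact lt_of_le_of_lt h hbq
  -- IVT on `g − b`
  have hββ : -β₀ ≤ β₀ := by linarith
  have hf : ContinuousOn (fun β => g β - 𝓫 β (G β)) (Icc (-β₀) β₀) := hgcont.sub hcont
  obtain ⟨βs, hβs, hzero⟩ : ∃ βs ∈ Icc (-β₀) β₀, g βs - 𝓫 βs (G βs) = 0 := by
    have hb1 := abs_lt.mp (hb (-β₀) habs1)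
    have hb2 := abs_lt.mp (hb β₀ habs2)
    rcases hsign with ⟨h1, h2⟩ | ⟨h1, h2⟩
    · have hlo : g (-β₀) - 𝓫 (-β₀) (G (-β₀)) ≤ 0 := by linarith
      have hhi : 0 ≤ g β₀ - 𝓫 β₀ (G β₀) := by linarith
      obtain ⟨βs, hβs, hval⟩ := intermediate_value_Icc hββ hf ⟨hlo, hhi⟩
      exact ⟨βs, hβs, hval⟩
    · have hlo : g β₀ - 𝓫 β₀ (G β₀) ≤ 0 := by linarith
      have hhi : 0 ≤ g (-β₀) - 𝓫 (-β₀) (G (-β₀)) := by linarith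
      obtain ⟨βs, hβs, hval⟩ := intermediate_value_Icc' hββ hf ⟨hlo, hhi⟩
      exact ⟨βs, hβs, hval⟩
  have hβs' : |βs| ≤ β₀ := abs_le.mpr ⟨hβs.1, hβs.2⟩
  have hbal : g βs = 𝓫 βs (G βs) := sub_eq_zero.mp hzero
  -- the rate `α₁ = α⁰ + β*` is nonzero
  have hα₁ : α0 + βs ≠ 0 := by
    have hθα : θ₀ ≤ |α| := hcl.2.2.2.2.2.2.2.2.2.2.1.1
    intro h0
    have hα0eq : α0 = -βs := eq_neg_of_add_eq_zero_left h0
    have h1 : |α| ≤ |α - α0| + |α0| := by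
      calc |α| = |(α - α0) + α0| := by congr 1; ring
        _ ≤ |α - α0| + |α0| := abs_add_le _ _
    rw [abs_sub_comm] at h1
    rw [hα0eq, abs_neg] at h1
    have h2 : |α0 - α| ≤ θ₀ / 4 := hα0
    rw [hα0eq] at h2
    have h3 : |-βs - α| = |α - -βs| := abs_sub_comm _ _
    linarith [hβs'.trans hβθ]
  obtain ⟨C₀, M, U, P, hconcl⟩ :=
    almostConcl_of_balanced hfam hgate hβs' (hG βs hβs').1 (hG βs hβs').2 hbal hhalf hηΓ hα₁
  exact ⟨α0 + βs, C₀, M, U, P, hconcl⟩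

end Summit.NavierStokesRegularity.NavierStokesRegularity.Theorems.DefectColumnGate

end
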